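import Summits.Ventures.YMGap.RobustBall.TermPerturbation
import HarnessLib

/-!
# RobustBall/PairActivity — the product of two loop traces `τ · (Re tr U_w₁/N) · (Re tr U_w₂/N)` as a local term
(cell `pub-ymgap`, track Y2 ROBUST-BALL, T0.2 witness (w3); p1)

HONEST FRAMING: elementary finite-torus bookkeeping (no probability, no continuum, no Clay claim). For two closed
words `w₁, w₂` the PAIR ACTIVITY `pairActivity N τ w₁ w₂ U = τ · (Re tr(hol_{w₁} U)/N) · (Re tr(hol_{w₂} U)/N)` is
gauge invariant, measurable, bounded by `|τ|`, reads the links of `w₁ ++ w₂`, is centre-slab invariant for balanced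
words, has single-link oscillation witness `2|τ| · mult_{w₁ ++ w₂}` and — because each factor is bounded by `1` and
`(1/√N)·mult`-Lipschitz — Frobenius-Lipschitz witness `(|τ|/√N) · mult_{w₁ ++ w₂}`. Packaged as the local term
`LocalTerm.ofPair` for the generic assembly of `RobustBall/TermPerturbation`.
-/

noncomputable section

open MeasureTheory Finset Function
open Literature.Probability.LatticeModels Literature.Probability.LatticeModels.DobrushinMetric
open Literature.MathematicalPhysics.QuantumLattice hiding torusNorm
open Literature.MathematicalPhysics.QuantumFieldTheory hiding ZdEdge

namespace Summit.Ventures.YMGap.RobustBall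

variable {d L N : ℕ}

/-- The normalised real trace of a word holonomy, `Re tr(hol_w U)/N`. [folklore] -/
def traceObs (N : ℕ) (w : List (Letter d L)) (U : GaugeConfig d L (SUN N)) : ℝ :=
  ((wordProd w U : SUN N) : Matrix (Fin N) (Fin N) ℂ).trace.re / N

/-- `|Re tr(hol)/N| ≤ 1`. [folklore] -/
theorem abs_traceObs_le (w : List (Letter d L)) (U : GaugeConfig d L (SUN N)) : |traceObs N w U| ≤ 1 :=
  abs_re_trace_div_le_one _

/-- One-link Lipschitz bound of the normalised trace: `|Δ| ≤ (1/√N) · mult_w(y) · d_F`. [folklore] -/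
theorem abs_traceObs_sub_le_mult (w : List (Letter d L)) {y : Edge d L} {U V : GaugeConfig d L (SUN N)}
    (h : ∀ z, z ≠ y → U z = V z) :
    |traceObs N w U - traceObs N w V| ≤ 1 / Real.sqrt N * mult w y * suFrobDist (U y) (V y) := by
  have key := abs_loopActivity_sub_le_mult (N := N) 1 w h
  simp only [loopActivity, one_mul, abs_one] at key
  rw [abs_sub_comm] at key
  have : (1 - traceObs N w V) - (1 - traceObs N w U) = traceObs N w U - traceObs N w V := by ring
  unfold traceObs at this ⊢
  rw [this] at key
  exact key

/-- The PAIR ACTIVITY of two words: `τ · (Re tr U_{w₁}/N) · (Re tr U_{w₂}/N)`. [folklore] -/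
def pairActivity (N : ℕ) (τ : ℝ) (w₁ w₂ : List (Letter d L)) (U : GaugeConfig d L (SUN N)) : ℝ :=
  τ * traceObs N w₁ U * traceObs N w₂ U

/-- `|pairActivity| ≤ |τ|`. [folklore] -/
theorem abs_pairActivity_le (τ : ℝ) (w₁ w₂ : List (Letter d L)) (U : GaugeConfig d L (SUN N)) :
    |pairActivity N τ w₁ w₂ U| ≤ |τ| := by
  unfold pairActivity
  rw [abs_mul, abs_mul]
  have h1 := abs_traceObs_le w₁ U
  have h2 := abs_traceObs_le w₂ U
  calc |τ| * |traceObs N w₁ U| * |traceObs N w₂ U| ≤ |τ| * 1 * 1 := by gcongr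
    _ = |τ| := by ring

/-- Oscillation of the pair activity between ANY two configurations is `≤ 2|τ|`. [folklore] -/
theorem abs_pairActivity_sub_le (τ : ℝ) (w₁ w₂ : List (Letter d L)) (U V : GaugeConfig d L (SUN N)) :
    |pairActivity N τ w₁ w₂ U - pairActivity N τ w₁ w₂ V| ≤ 2 * |τ| := by
  have h1 := abs_pairActivity_le τ w₁ w₂ U
  have h2 := abs_pairActivity_le τ w₁ w₂ V
  calc |pairActivity N τ w₁ w₂ U - pairActivity N τ w₁ w₂ V|
      ≤ |pairActivity N τ w₁ w₂ U| + |pairActivity N τ w₁ w₂ V| := abs_sub _ _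
    _ ≤ 2 * |τ| := by linarith

/-- **One-link Frobenius-Lipschitz bound of the pair activity**: if `U = V` off `y`,
`|A(U) − A(V)| ≤ (|τ|/√N) · mult_{w₁ ++ w₂}(y) · ‖U_y − V_y‖_F`. [folklore] -/
theorem abs_pairActivity_sub_le_mult (τ : ℝ) (w₁ w₂ : List (Letter d L)) {y : Edge d L}
    {U V : GaugeConfig d L (SUN N)} (h : ∀ z, z ≠ y → U z = V z) :
    |pairActivity N τ w₁ w₂ U - pairActivity N τ w₁ w₂ V| ≤
      |τ| / Real.sqrt N * mult (w₁ ++ w₂) y * suFrobDist (U y) (V y) := by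
  have ha := abs_traceObs_sub_le_mult (N := N) w₁ h
  have hb := abs_traceObs_sub_le_mult (N := N) w₂ h
  have ha1 := abs_traceObs_le (N := N) w₁ V
  have hb1 := abs_traceObs_le (N := N) w₂ U
  have hD : 0 ≤ suFrobDist (U y) (V y) := suFrobDist_nonneg _ _
  have hs : 0 ≤ 1 / Real.sqrt N := by positivity
  have hsplit : pairActivity N τ w₁ w₂ U - pairActivity N τ w₁ w₂ V =
      τ * ((traceObs N w₁ U - traceObs N w₁ V) * traceObs N w₂ U +
        traceObs N w₁ V * (traceObs N w₂ U - traceObs N w₂ V)) := by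
    unfold pairActivity; ring
  rw [hsplit, abs_mul]
  have hmult : (mult (w₁ ++ w₂) y : ℝ) = mult w₁ y + mult w₂ y := by
    simp [mult, List.map_append, List.count_append]
  rw [hmult]
  have h1 : |(traceObs N w₁ U - traceObs N w₁ V) * traceObs N w₂ U| ≤
      1 / Real.sqrt N * mult w₁ y * suFrobDist (U y) (V y) := by
    rw [abs_mul]
    calc |traceObs N w₁ U - traceObs N w₁ V| * |traceObs N w₂ U|
        ≤ (1 / Real.sqrt N * mult w₁ y * suFrobDist (U y) (V y)) * 1 := by gcongr
      _ = _ := mul_one _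
  have h2 : |traceObs N w₁ V * (traceObs N w₂ U - traceObs N w₂ V)| ≤
      1 / Real.sqrt N * mult w₂ y * suFrobDist (U y) (V y) := by
    rw [abs_mul]
    calc |traceObs N w₁ V| * |traceObs N w₂ U - traceObs N w₂ V|
        ≤ 1 * (1 / Real.sqrt N * mult w₂ y * suFrobDist (U y) (V y)) := by gcongr
      _ = _ := one_mul _
  calc |τ| * |(traceObs N w₁ U - traceObs N w₁ V) * traceObs N w₂ U +
          traceObs N w₁ V * (traceObs N w₂ U - traceObs N w₂ V)|
      ≤ |τ| * (1 / Real.sqrt N * mult w₁ y * suFrobDist (U y) (V y) +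
          1 / Real.sqrt N * mult w₂ y * suFrobDist (U y) (V y)) :=
        mul_le_mul_of_nonneg_left ((abs_add_le _ _).trans (add_le_add h1 h2)) (abs_nonneg τ)
    _ = |τ| / Real.sqrt N * (mult w₁ y + mult w₂ y) * suFrobDist (U y) (V y) := by ring

/-- The pair activity is measurable. [folklore] -/
theorem measurable_pairActivity (τ : ℝ) (w₁ w₂ : List (Letter d L)) :
    Measurable (pairActivity (d := d) (L := L) N τ w₁ w₂) := by
  unfold pairActivity traceObs
  exact (measurable_const.mul ((continuous_re_trace_su.measurable.comp (measurable_wordProd w₁)).div_const _)).mul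
    ((continuous_re_trace_su.measurable.comp (measurable_wordProd w₂)).div_const _)

/-- The pair activity of two closed walks is gauge invariant. [folklore] -/
theorem isGaugeInvariant_pairActivity {w₁ w₂ : List (Letter d L)} {s₁ s₂ : Site d L} (hw₁ : IsWalk s₁ w₁ s₁)
    (hw₂ : IsWalk s₂ w₂ s₂) (τ : ℝ) : IsGaugeInvariant (pairActivity (d := d) (L := L) N τ w₁ w₂) :=
  fun g U => by
    simp only [pairActivity, traceObs, re_trace_wordProd_gaugeTransform hw₁, re_trace_wordProd_gaugeTransform hw₂]

/-- The pair activity reads only the links of the two words. [folklore] -/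
theorem dependsOn_pairActivity (τ : ℝ) (w₁ w₂ : List (Letter d L)) :
    DependsOn (pairActivity (d := d) (L := L) N τ w₁ w₂) (↑(wordEdges (w₁ ++ w₂)) : Set (Edge d L)) := by
  intro U V h
  have h1 : wordProd w₁ U = (wordProd w₁ V : SUN N) :=
    wordProd_congr fun l hl => h _ (Finset.mem_coe.2 (mem_wordEdges.2 ⟨l, List.mem_append_left _ hl, rfl⟩))
  have h2 : wordProd w₂ U = (wordProd w₂ V : SUN N) :=
    wordProd_congr fun l hl => h _ (Finset.mem_coe.2 (mem_wordEdges.2 ⟨l, List.mem_append_right _ hl, rfl⟩))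
  simp only [pairActivity, traceObs, h1, h2]

/-- The pair activity of balanced words is centre-slab invariant. [folklore] -/
theorem pairActivity_centerSlabRotate {w₁ w₂ : List (Letter d L)} (hw₁ : ∀ v t, netCount w₁ v t = 0)
    (hw₂ : ∀ v t, netCount w₂ v t = 0) (τ : ℝ) (v : Fin d) (t : ZMod L) {z : SUN N}
    (hz : z ∈ Subgroup.center (SUN N)) (U : GaugeConfig d L (SUN N)) :
    pairActivity N τ w₁ w₂ (centerSlabRotate v t z U) = pairActivity N τ w₁ w₂ U := by
  simp only [pairActivity, traceObs, wordProd_centerSlabRotate_of_balanced hw₁ v t hz,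
    wordProd_centerSlabRotate_of_balanced hw₂ v t hz]

/-- The single-link OSCILLATION witness of the pair activity: `2|τ| · mult_{w₁ ++ w₂}(e)`. [folklore] -/
theorem isOscBound_pairActivity (τ : ℝ) (w₁ w₂ : List (Letter d L)) :
    Dobrushin.IsOscBound (pairActivity (d := d) (L := L) N τ w₁ w₂) fun e => 2 * |τ| * mult (w₁ ++ w₂) e := by
  refine ⟨fun e => by positivity, fun y U V h => ?_⟩
  rcases Nat.eq_zero_or_pos (mult (w₁ ++ w₂) y) with hm | hm
  · have : pairActivity N τ w₁ w₂ U = pairActivity N τ w₁ w₂ V :=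
      dependsOn_pairActivity τ w₁ w₂ fun e he => h e fun hey => by
        rw [hey] at he; exact (mult_eq_zero_iff.1 hm) he
    rw [this, sub_self, abs_zero]; positivity
  · refine (abs_pairActivity_sub_le τ w₁ w₂ U V).trans ?_
    have : (1 : ℝ) ≤ mult (w₁ ++ w₂) y := by exact_mod_cast hm
    nlinarith [abs_nonneg τ]

/-- The single-link Frobenius-LIPSCHITZ witness of the pair activity: `(|τ|/√N) · mult_{w₁ ++ w₂}(e)`. [folklore] -/
theorem isLipBound_pairActivity (τ : ℝ) (w₁ w₂ : List (Letter d L)) :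
    IsLipBound suFrobDist (pairActivity (d := d) (L := L) N τ w₁ w₂) fun e => |τ| / Real.sqrt N * mult (w₁ ++ w₂) e :=
  ⟨fun e => by positivity, fun y U V h => abs_pairActivity_sub_le_mult τ w₁ w₂ h⟩

/-- **The pair term** of two closed words `w₁, w₂` (based at `x₁, x₂`) with letters in `code`: activity
`τ (Re tr U_{w₁}/N)(Re tr U_{w₂}/N)`, letters `w₁ ++ w₂`, constants `oscC = 2|τ|`, `lipC = |τ|/√N`. [folklore] -/
def LocalTerm.ofPair (N : ℕ) (τ : ℝ) (w₁ w₂ : List (Letter d L)) (code : Finset (Site d L)) (x₁ x₂ : Site d L)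
    (hw₁ : IsWalk x₁ w₁ x₁) (hw₂ : IsWalk x₂ w₂ x₂) (hcode : ∀ l ∈ w₁ ++ w₂, l.site ∈ code) : LocalTerm d L N where
  act := pairActivity N τ w₁ w₂
  letters := w₁ ++ w₂
  code := code
  site_mem := hcode
  dependsOn := dependsOn_pairActivity τ w₁ w₂
  gaugeInvariant := isGaugeInvariant_pairActivity hw₁ hw₂ τ
  measurable := measurable_pairActivity τ w₁ w₂
  bound := |τ|
  abs_le := abs_pairActivity_le τ w₁ w₂
  oscC := 2 * |τ|
  lipC := |τ| / Real.sqrt N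
  isOscBound := isOscBound_pairActivity τ w₁ w₂
  isLipBound := isLipBound_pairActivity τ w₁ w₂

end Summit.Ventures.YMGap.RobustBall

end
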